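import Summits.QuantumFields.BalabanUV.T4Continuum.Support.SkeletonPrecompGrad

/-!
# T⁴ programme, node NE3 — kinematic refinement lemma, row R1-asm: ONE THRESHOLD FOR THE R1 END's NUMERIC SIDE
# CONDITIONS AND LINEAR ENVELOPES OF ITS CLOSED CONSTANTS (pure real arithmetic)

NE3 formalisation swarm, LEAF PROVER 09 gen 2 (unit `b2b-balaban-t4-ne3-formalise-leaf-09`), row **R1-asm** of
`t4/formal/NE3/LEAVES.md` («the four side conditions proved from a stated smallness of `b, c` or left as END-A″'s
binders»).  The R1 END (`ApproxRefineGradReduce.approxRefine_of_rootClose` p213202 at the root-closeness radius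
`r = 24dG₀ + 224(d+1)²A²` of part 3c `ApproxRefineEnd`, `A = (8d−7)b`, `G₀ = (2d−1)c + gradRem(d)b²`) carries FIVE
`j`-uniform numeric inequalities on `(b, c)` (`h16 hdb hquarter hhalf h512`) and CLOSED constants
`b₁ = 4A + 48dL²G₀ + 128(2d+1)²L²A²`, `c₁ = L³(32dA(4A + r + 12G₀) + 4r + 24G₀)`; the owner's regime
(`MinimalActionRegime.regime_of_small`, p213122) wants `b, c, b₁, c₁ ≤ t` under one threshold.  THIS FILE (0 defs, 0
sorry, [folklore] arithmetic only; imports `SkeletonPrecompGrad` for `gradRem`, `precompCoeff`):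
* §1 atoms under `0 ≤ b ≤ t`, `0 ≤ c ≤ t`, `t ≤ 1`, `1 ≤ d`: `A ≤ 8dt`, `A² ≤ 64d²t`, `G₀ ≤ (2d + gradRem d)t`;
* §2 envelopes: **`rootRadius_le_of_small`** `r ≤ (24d(2d + Γ) + 14336d²(d+1)²)·t`, **`fillRadius_le_of_small`**
  `b₁ ≤ (32d + 48dL²(2d + Γ) + 8192d²(2d+1)²L²)·t`, **`gradRadius_le_of_small`** `c₁ ≤ L³(256d²H + 4R + 24(2d + Γ))·t`
  (`Γ = gradRem d`, `R = 24d(2d + Γ) + 14336d²(d+1)²`, `H = 32d + R + 12(2d + Γ)`);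
* §3 **`sideConds_of_small`** — ONE THRESHOLD `K(d, L)·t ≤ 1`,
  `K = 160d + 168d² + 2H + 512(d+1)(d+4)L²·(32d + 48dL²(2d + Γ) + 8192d²(2d+1)²L²)`, gives the five inequalities
  LITERALLY as the R1 END states them.
At `d = 4`, `L = 2` (`gradRem 4 = 3588`): `K = 3 705 187 002 400 ≈ 3.7·10¹²`, i.e. `t ≤ 2.7·10⁻¹³` — crude and
explicit (v1.1: this number corrected; v1 printed `1.2·10¹⁰` in error; declarations unchanged).

HONEST FRAMING.  Arithmetic bookkeeping; no configuration, no minimiser, no printed sentence is a hypothesis; no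
`def`, no `sorry`; axioms ⊆ {propext, Classical.choice, Quot.sound}.  **NE3 is NOT proved**; `ApproxRefine` is NOT
proved here (part 3c `ApproxRefineEnd` after row S4d's F4 chain lands); spine PROVED 0/9; `BetaPertH`, (B), G-an2-4
occur nowhere; finite T⁴ rung (B)+1 — NOT infinite volume, NOT a mass gap, NOT the Clay problem.  HONEST DEPENDENCY
(cell page 1): continuum YM on T⁴ ⇐ BetaPertH ∧ nine spine estimates (0/9 proved); BetaPertH ⇐ (D1) ∧ (D4) ∧ CAP+tail;
G-an2-4 gates asym, D1 and NE2/3/4.  PLACEMENT (human rule 2026-08-19): under `Summits/QuantumFields/BalabanUV/`;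
moves nothing.
-/

set_option autoImplicit false

namespace Summit.QuantumFields.BalabanUV.T4Continuum.ApproxRefineRegime

open SkeletonPrecomp (precompCoeff precompCoeff_nonneg precompCoeff_le_half)
open SkeletonPrecompGrad (gradRem gradRem_nonneg)

noncomputable section

variable {d : ℕ}

/-! ## §1 Atoms -/

/-- `b² ≤ t` for `0 ≤ b ≤ t ≤ 1`. [folklore] -/
theorem sq_le_of_small {b t : ℝ} (hb : 0 ≤ b) (hbt : b ≤ t) (ht1 : t ≤ 1) : b ^ 2 ≤ t := by nlinarith

/-- `A = (8d−7)b ≤ 8dt` for `1 ≤ d`, `0 ≤ b ≤ t`. [folklore] -/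
theorem plaqAtom_le_of_small (hd : 1 ≤ d) {b t : ℝ} (hb : 0 ≤ b) (hbt : b ≤ t) : ((8 * (d : ℝ) - 7) * b) ≤ 8 * d * t := by
  have hd1 : (1 : ℝ) ≤ d := by exact_mod_cast hd
  have h87 : 0 ≤ 8 * (d : ℝ) - 7 := by linarith
  have ht0 : 0 ≤ t := hb.trans hbt
  calc (8 * (d : ℝ) - 7) * b ≤ (8 * (d : ℝ) - 7) * t := mul_le_mul_of_nonneg_left hbt h87
    _ ≤ 8 * d * t := by nlinarith

/-- `A² ≤ 64d²t` for `1 ≤ d`, `0 ≤ b ≤ t ≤ 1`. [folklore] -/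
theorem plaqAtom_sq_le_of_small (hd : 1 ≤ d) {b t : ℝ} (hb : 0 ≤ b) (hbt : b ≤ t) (ht1 : t ≤ 1) :
    ((8 * (d : ℝ) - 7) * b) ^ 2 ≤ 64 * (d : ℝ) ^ 2 * t := by
  have hd1 : (1 : ℝ) ≤ d := by exact_mod_cast hd
  have hA0 : 0 ≤ (8 * (d : ℝ) - 7) * b := mul_nonneg (by linarith) hb
  have ht0 : 0 ≤ t := hb.trans hbt
  have h := pow_le_pow_left₀ hA0 (plaqAtom_le_of_small hd hb hbt) 2
  calc ((8 * (d : ℝ) - 7) * b) ^ 2 ≤ (8 * d * t) ^ 2 := h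
    _ = 64 * (d : ℝ) ^ 2 * (t * t) := by ring
    _ ≤ 64 * (d : ℝ) ^ 2 * t := by
        apply mul_le_mul_of_nonneg_left _ (by positivity); nlinarith

/-- `G₀ = (2d−1)c + gradRem(d)b² ≤ (2d + gradRem d)t` for `1 ≤ d`, `0 ≤ b ≤ t ≤ 1`, `0 ≤ c ≤ t`. [folklore] -/
theorem gradAtom_le_of_small (hd : 1 ≤ d) {b c t : ℝ} (hb : 0 ≤ b) (hbt : b ≤ t) (hct : c ≤ t)
    (ht1 : t ≤ 1) : ((2 * (d : ℝ) - 1) * c + gradRem d * b ^ 2) ≤ (2 * (d : ℝ) + gradRem d) * t := by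
  have hd1 : (1 : ℝ) ≤ d := by exact_mod_cast hd
  have ht0 : 0 ≤ t := hb.trans hbt
  have h1 : (2 * (d : ℝ) - 1) * c ≤ 2 * (d : ℝ) * t := by
    calc (2 * (d : ℝ) - 1) * c ≤ (2 * (d : ℝ) - 1) * t := mul_le_mul_of_nonneg_left hct (by linarith)
      _ ≤ 2 * (d : ℝ) * t := by nlinarith
  have h2 : gradRem d * b ^ 2 ≤ gradRem d * t :=
    mul_le_mul_of_nonneg_left (sq_le_of_small hb hbt ht1) (gradRem_nonneg hd)
  calc (2 * (d : ℝ) - 1) * c + gradRem d * b ^ 2 ≤ 2 * (d : ℝ) * t + gradRem d * t := add_le_add h1 h2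
    _ = (2 * (d : ℝ) + gradRem d) * t := by ring

/-! ## §2 Linear envelopes of the closed constants -/

/-- **Root-closeness radius**: `r = 24dG₀ + 224(d+1)²A² ≤ (24d(2d + gradRem d) + 14336d²(d+1)²)·t`. [folklore] -/
theorem rootRadius_le_of_small (hd : 1 ≤ d) {b c t : ℝ} (hb : 0 ≤ b) (hbt : b ≤ t) (hct : c ≤ t)
    (ht1 : t ≤ 1) :
    (24 * d * ((2 * (d : ℝ) - 1) * c + gradRem d * b ^ 2) + 224 * ((d : ℝ) + 1) ^ 2 * ((8 * (d : ℝ) - 7) * b) ^ 2)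
      ≤ (24 * d * (2 * (d : ℝ) + gradRem d) + 14336 * (d : ℝ) ^ 2 * ((d : ℝ) + 1) ^ 2) * t := by
  have ht0 : 0 ≤ t := hb.trans hbt
  have hG := gradAtom_le_of_small hd hb hbt hct ht1
  have hA := plaqAtom_sq_le_of_small hd hb hbt ht1
  have hd0 : (0 : ℝ) ≤ d := by positivity
  calc 24 * d * ((2 * (d : ℝ) - 1) * c + gradRem d * b ^ 2) + 224 * ((d : ℝ) + 1) ^ 2 * ((8 * (d : ℝ) - 7) * b) ^ 2
      ≤ 24 * d * ((2 * (d : ℝ) + gradRem d) * t) + 224 * ((d : ℝ) + 1) ^ 2 * (64 * (d : ℝ) ^ 2 * t) := by gcongr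
    _ = (24 * d * (2 * (d : ℝ) + gradRem d) + 14336 * (d : ℝ) ^ 2 * ((d : ℝ) + 1) ^ 2) * t := by ring

/-- **Small-field radius of the filling**: `b₁ = 4A + 48dL²G₀ + 128(2d+1)²L²A² ≤ (32d + 48dL²(2d + gradRem d) +
8192d²(2d+1)²L²)·t`. [folklore] -/
theorem fillRadius_le_of_small (hd : 1 ≤ d) (L : ℕ) {b c t : ℝ} (hb : 0 ≤ b) (hbt : b ≤ t)
    (hct : c ≤ t) (ht1 : t ≤ 1) :
    (4 * (8 * (d : ℝ) - 7) * b + 48 * d * (L : ℝ) ^ 2 * ((2 * (d : ℝ) - 1) * c + gradRem d * b ^ 2)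
        + 128 * (2 * (d : ℝ) + 1) ^ 2 * (L : ℝ) ^ 2 * ((8 * (d : ℝ) - 7) * b) ^ 2)
      ≤ (32 * d + 48 * d * (L : ℝ) ^ 2 * (2 * (d : ℝ) + gradRem d)
            + 8192 * (d : ℝ) ^ 2 * (2 * (d : ℝ) + 1) ^ 2 * (L : ℝ) ^ 2) * t := by
  have ht0 : 0 ≤ t := hb.trans hbt
  have hG := gradAtom_le_of_small hd hb hbt hct ht1
  have hA := plaqAtom_sq_le_of_small hd hb hbt ht1
  have hA1 := plaqAtom_le_of_small hd hb hbt
  have hd0 : (0 : ℝ) ≤ d := by positivity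
  have e4 : 4 * (8 * (d : ℝ) - 7) * b = 4 * ((8 * (d : ℝ) - 7) * b) := by ring
  rw [e4]
  calc 4 * ((8 * (d : ℝ) - 7) * b) + 48 * d * (L : ℝ) ^ 2 * ((2 * (d : ℝ) - 1) * c + gradRem d * b ^ 2)
        + 128 * (2 * (d : ℝ) + 1) ^ 2 * (L : ℝ) ^ 2 * ((8 * (d : ℝ) - 7) * b) ^ 2
      ≤ 4 * (8 * d * t) + 48 * d * (L : ℝ) ^ 2 * ((2 * (d : ℝ) + gradRem d) * t)
        + 128 * (2 * (d : ℝ) + 1) ^ 2 * (L : ℝ) ^ 2 * (64 * (d : ℝ) ^ 2 * t) := by gcongr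
    _ = (32 * d + 48 * d * (L : ℝ) ^ 2 * (2 * (d : ℝ) + gradRem d)
            + 8192 * (d : ℝ) ^ 2 * (2 * (d : ℝ) + 1) ^ 2 * (L : ℝ) ^ 2) * t := by ring

/-- The inner sum `4A + r + 12G₀ ≤ (32d + R + 12(2d + gradRem d))·t`, `R = 24d(2d + gradRem d) + 14336d²(d+1)²`.
[folklore] -/
theorem halfSum_le_of_small (hd : 1 ≤ d) {b c t : ℝ} (hb : 0 ≤ b) (hbt : b ≤ t) (hct : c ≤ t)
    (ht1 : t ≤ 1) :
    4 * ((8 * (d : ℝ) - 7) * b)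
        + (24 * d * ((2 * (d : ℝ) - 1) * c + gradRem d * b ^ 2) + 224 * ((d : ℝ) + 1) ^ 2 * ((8 * (d : ℝ) - 7) * b) ^ 2)
        + 12 * ((2 * (d : ℝ) - 1) * c + gradRem d * b ^ 2)
      ≤ (32 * d + (24 * d * (2 * (d : ℝ) + gradRem d) + 14336 * (d : ℝ) ^ 2 * ((d : ℝ) + 1) ^ 2)
            + 12 * (2 * (d : ℝ) + gradRem d)) * t := by
  have hG := gradAtom_le_of_small hd hb hbt hct ht1
  have hR := rootRadius_le_of_small hd hb hbt hct ht1
  have hA1 := plaqAtom_le_of_small hd hb hbt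
  calc _ ≤ 4 * (8 * d * t) + (24 * d * (2 * (d : ℝ) + gradRem d) + 14336 * (d : ℝ) ^ 2 * ((d : ℝ) + 1) ^ 2) * t
        + 12 * ((2 * (d : ℝ) + gradRem d) * t) := by gcongr
    _ = (32 * d + (24 * d * (2 * (d : ℝ) + gradRem d) + 14336 * (d : ℝ) ^ 2 * ((d : ℝ) + 1) ^ 2)
            + 12 * (2 * (d : ℝ) + gradRem d)) * t := by ring

/-- **Flux-gradient constant of the filling**: `c₁ = L³(32dA(4A + r + 12G₀) + 4r + 24G₀) ≤ L³(256d²H + 4R +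
24(2d + gradRem d))·t`, `H = 32d + R + 12(2d + gradRem d)`. [folklore] -/
theorem gradRadius_le_of_small (hd : 1 ≤ d) (L : ℕ) {b c t : ℝ} (hb : 0 ≤ b) (hc : 0 ≤ c) (hbt : b ≤ t)
    (hct : c ≤ t) (ht1 : t ≤ 1) :
    ((L : ℝ) ^ 3 * (32 * d * ((8 * (d : ℝ) - 7) * b)
            * (4 * ((8 * (d : ℝ) - 7) * b)
              + (24 * d * ((2 * (d : ℝ) - 1) * c + gradRem d * b ^ 2) + 224 * ((d : ℝ) + 1) ^ 2 * ((8 * (d : ℝ) - 7) * b) ^ 2)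
              + 12 * ((2 * (d : ℝ) - 1) * c + gradRem d * b ^ 2))
          + 4 * (24 * d * ((2 * (d : ℝ) - 1) * c + gradRem d * b ^ 2) + 224 * ((d : ℝ) + 1) ^ 2 * ((8 * (d : ℝ) - 7) * b) ^ 2)
          + 24 * ((2 * (d : ℝ) - 1) * c + gradRem d * b ^ 2)))
      ≤ ((L : ℝ) ^ 3 * (256 * (d : ℝ) ^ 2 * (32 * d + (24 * d * (2 * (d : ℝ) + gradRem d) + 14336 * (d : ℝ) ^ 2 * ((d : ℝ) + 1) ^ 2)
            + 12 * (2 * (d : ℝ) + gradRem d))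
          + 4 * (24 * d * (2 * (d : ℝ) + gradRem d) + 14336 * (d : ℝ) ^ 2 * ((d : ℝ) + 1) ^ 2)
          + 24 * (2 * (d : ℝ) + gradRem d))) * t := by
  have hd1 : (1 : ℝ) ≤ d := by exact_mod_cast hd
  have ht0 : 0 ≤ t := hb.trans hbt
  have hd0 : (0 : ℝ) ≤ d := by positivity
  have hΓ := gradRem_nonneg hd
  have hG := gradAtom_le_of_small hd hb hbt hct ht1
  have hR := rootRadius_le_of_small hd hb hbt hct ht1
  have hA1 := plaqAtom_le_of_small hd hb hbt
  have hH := halfSum_le_of_small hd hb hbt hct ht1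
  have hA0 : 0 ≤ ((8 * (d : ℝ) - 7) * b) := mul_nonneg (by linarith) hb
  have hG0 : 0 ≤ ((2 * (d : ℝ) - 1) * c + gradRem d * b ^ 2) :=
    add_nonneg (mul_nonneg (by linarith) hc) (mul_nonneg hΓ (sq_nonneg b))
  -- atomise
  set A : ℝ := ((8 * (d : ℝ) - 7) * b) with hAdef
  set G : ℝ := ((2 * (d : ℝ) - 1) * c + gradRem d * b ^ 2) with hGdef
  set Rr : ℝ := 24 * d * G + 224 * ((d : ℝ) + 1) ^ 2 * A ^ 2 with hRrdef
  set T : ℝ := (2 * (d : ℝ) + gradRem d) with hTdef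
  set RK : ℝ := 24 * d * T + 14336 * (d : ℝ) ^ 2 * ((d : ℝ) + 1) ^ 2 with hRKdef
  set H : ℝ := 32 * d + RK + 12 * T with hHdef
  have hRr0 : 0 ≤ Rr := by positivity
  have hS0 : 0 ≤ 4 * A + Rr + 12 * G := by positivity
  have hT0 : 0 ≤ T := by positivity
  have hRK0 : 0 ≤ RK := by positivity
  have hH0 : 0 ≤ H := by positivity
  -- the product term: `32dA·(…) ≤ 32d·8dt·(H t) ≤ 256d²H·t`
  have hprod : 32 * d * A * (4 * A + Rr + 12 * G) ≤ 256 * (d : ℝ) ^ 2 * H * t := by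
    calc 32 * d * A * (4 * A + Rr + 12 * G) ≤ 32 * d * (8 * d * t) * (H * t) := by gcongr
      _ = 256 * (d : ℝ) ^ 2 * H * (t * t) := by ring
      _ ≤ 256 * (d : ℝ) ^ 2 * H * t := by
          apply mul_le_mul_of_nonneg_left _ (by positivity); nlinarith
  have hL0 : (0 : ℝ) ≤ (L : ℝ) ^ 3 := by positivity
  calc (L : ℝ) ^ 3 * (32 * d * A * (4 * A + Rr + 12 * G) + 4 * Rr + 24 * G)
      ≤ (L : ℝ) ^ 3 * (256 * (d : ℝ) ^ 2 * H * t + 4 * (RK * t) + 24 * (T * t)) :=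
        mul_le_mul_of_nonneg_left (add_le_add (add_le_add hprod (by linarith)) (by linarith)) hL0
    _ = (L : ℝ) ^ 3 * (256 * (d : ℝ) ^ 2 * H + 4 * RK + 24 * T) * t := by ring

/-! ## §3 One threshold for the five side conditions of the R1 END -/

/-- Four nonnegative parts of a sum `(x₁ + x₂ + x₃ + x₄)·t ≤ 1` (`t ≥ 0`) each satisfy `xᵢ·t ≤ 1`. [folklore] -/
theorem parts_le_of_sum_le {x₁ x₂ x₃ x₄ t : ℝ} (h₁ : 0 ≤ x₁) (h₂ : 0 ≤ x₂) (h₃ : 0 ≤ x₃) (h₄ : 0 ≤ x₄) (ht : 0 ≤ t)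
    (h : (x₁ + x₂ + x₃ + x₄) * t ≤ 1) : x₁ * t ≤ 1 ∧ x₂ * t ≤ 1 ∧ x₃ * t ≤ 1 ∧ x₄ * t ≤ 1 := by
  have e : (x₁ + x₂ + x₃ + x₄) * t = x₁ * t + x₂ * t + x₃ * t + x₄ * t := by ring
  rw [e] at h
  have m₁ := mul_nonneg h₁ ht; have m₂ := mul_nonneg h₂ ht; have m₃ := mul_nonneg h₃ ht; have m₄ := mul_nonneg h₄ ht
  exact ⟨by linarith, by linarith, by linarith, by linarith⟩

/-- **ONE THRESHOLD**: for `1 ≤ d`, `1 ≤ L`, `0 ≤ b ≤ t`, `0 ≤ c ≤ t` and `K(d, L)·t ≤ 1` with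
`K = 160d + 168d² + 2H + 512(d+1)(d+4)L²·(32d + 48dL²(2d + Γ) + 8192d²(2d+1)²L²)` (`Γ = gradRem d`,
`R = 24d(2d + Γ) + 14336d²(d+1)²`, `H = 32d + R + 12(2d + Γ)`), the five numeric hypotheses `h16 hdb hquarter hhalf h512`
of the R1 END `ApproxRefineEnd.approxRefine_sfClass` hold LITERALLY. [folklore] -/
theorem sideConds_of_small (hd : 1 ≤ d) {L : ℕ} (hL : 1 ≤ L) {b c t : ℝ} (hb : 0 ≤ b) (hc : 0 ≤ c) (hbt : b ≤ t)
    (hct : c ≤ t)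
    (hK : (160 * d + 168 * (d : ℝ) ^ 2 + 2 * (32 * d + (24 * d * (2 * (d : ℝ) + gradRem d) + 14336 * (d : ℝ) ^ 2 * ((d : ℝ) + 1) ^ 2)
            + 12 * (2 * (d : ℝ) + gradRem d))
        + 512 * ((d : ℝ) + 1) * ((d : ℝ) + 4) * (L : ℝ) ^ 2
          * (32 * d + 48 * d * (L : ℝ) ^ 2 * (2 * (d : ℝ) + gradRem d)
            + 8192 * (d : ℝ) ^ 2 * (2 * (d : ℝ) + 1) ^ 2 * (L : ℝ) ^ 2)) * t ≤ 1) :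
    (8 * (d : ℝ) - 7) * b ≤ 1 / 16 ∧ ((d : ℝ) - 1) * b ≤ 1 / 32 ∧
    (2 * (precompCoeff L * (((d : ℝ) - 1) * c)) + 37 * (((d : ℝ) - 1) * b) ^ 2
      + 4 * b * (((d : ℝ) - 1) * b) ≤ 1 / 4) ∧
    (4 * ((8 * (d : ℝ) - 7) * b)
        + (24 * d * ((2 * (d : ℝ) - 1) * c + gradRem d * b ^ 2) + 224 * ((d : ℝ) + 1) ^ 2 * ((8 * (d : ℝ) - 7) * b) ^ 2)
        + 12 * ((2 * (d : ℝ) - 1) * c + gradRem d * b ^ 2) ≤ 1 / 2) ∧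
    (512 * (d + 1) * (d + 4) * (L : ℝ) ^ 2
      * (4 * (8 * (d : ℝ) - 7) * b + 48 * d * (L : ℝ) ^ 2 * ((2 * (d : ℝ) - 1) * c + gradRem d * b ^ 2)
        + 128 * (2 * (d : ℝ) + 1) ^ 2 * (L : ℝ) ^ 2 * ((8 * (d : ℝ) - 7) * b) ^ 2) ≤ 1) := by
  have hd1 : (1 : ℝ) ≤ d := by exact_mod_cast hd
  have hd0 : (0 : ℝ) ≤ d := by positivity
  have ht0 : 0 ≤ t := hb.trans hbt
  have hΓ := gradRem_nonneg hd
  -- atomise the constants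
  set T : ℝ := (2 * (d : ℝ) + gradRem d) with hTdef
  set RK : ℝ := 24 * d * T + 14336 * (d : ℝ) ^ 2 * ((d : ℝ) + 1) ^ 2 with hRKdef
  set H : ℝ := 32 * d + RK + 12 * T with hHdef
  set B : ℝ := 32 * d + 48 * d * (L : ℝ) ^ 2 * T + 8192 * (d : ℝ) ^ 2 * (2 * (d : ℝ) + 1) ^ 2 * (L : ℝ) ^ 2
    with hBdef
  have hT0 : 0 ≤ T := by positivity
  have hRK0 : 0 ≤ RK := by positivity
  have hH0 : 0 ≤ H := by positivity
  have hB0 : 0 ≤ B := by positivity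
  obtain ⟨h160, h168, h2H, h512K⟩ := parts_le_of_sum_le (x₁ := 160 * d) (x₂ := 168 * (d : ℝ) ^ 2) (x₃ := 2 * H)
    (x₄ := 512 * ((d : ℝ) + 1) * ((d : ℝ) + 4) * (L : ℝ) ^ 2 * B)
    (by positivity) (by positivity) (by positivity) (by positivity) ht0 hK
  -- `t ≤ 1` (indeed `160·d·t ≤ 1`, `d ≥ 1`)
  have hdt : t ≤ (d : ℝ) * t := by nlinarith
  have ht1 : t ≤ 1 := by linarith
  have hA1 := plaqAtom_le_of_small hd hb hbt
  have hsq := sq_le_of_small hb hbt ht1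
  refine ⟨?_, ?_, ?_, ?_, ?_⟩
  · -- h16: `(8d−7)b ≤ 8dt ≤ 1/16`
    linarith
  · -- hdb: `(d−1)b ≤ dt ≤ 1/32`
    have h1 : (d : ℝ) * b ≤ (d : ℝ) * t := mul_le_mul_of_nonneg_left hbt hd0
    have h2 : ((d : ℝ) - 1) * b = (d : ℝ) * b - b := by ring
    rw [h2]; linarith
  · -- hquarter: `≤ (5d + 37d²)t ≤ 42d²t ≤ 1/4`
    have hpc0 := precompCoeff_nonneg hL
    have hpc := precompCoeff_le_half hL
    have hdc : 0 ≤ ((d : ℝ) - 1) * c := mul_nonneg (by linarith) hc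
    have e1 : 2 * (precompCoeff L * (((d : ℝ) - 1) * c)) ≤ (d : ℝ) * t := by
      calc 2 * (precompCoeff L * (((d : ℝ) - 1) * c)) ≤ 2 * (1 / 2 * (((d : ℝ) - 1) * c)) := by gcongr
        _ = ((d : ℝ) - 1) * c := by ring
        _ ≤ ((d : ℝ) - 1) * t := mul_le_mul_of_nonneg_left hct (by linarith)
        _ ≤ (d : ℝ) * t := by nlinarith
    have e2 : 37 * (((d : ℝ) - 1) * b) ^ 2 ≤ 37 * (d : ℝ) ^ 2 * t := by
      have e : (((d : ℝ) - 1) * b) ^ 2 = ((d : ℝ) - 1) ^ 2 * b ^ 2 := by ring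
      rw [e]
      have h3 : ((d : ℝ) - 1) ^ 2 ≤ (d : ℝ) ^ 2 := by nlinarith
      calc 37 * (((d : ℝ) - 1) ^ 2 * b ^ 2) ≤ 37 * ((d : ℝ) ^ 2 * t) := by gcongr
        _ = 37 * (d : ℝ) ^ 2 * t := by ring
    have e3 : 4 * b * (((d : ℝ) - 1) * b) ≤ 4 * (d : ℝ) * t := by
      have e : 4 * b * (((d : ℝ) - 1) * b) = 4 * ((d : ℝ) - 1) * b ^ 2 := by ring
      rw [e]
      calc 4 * ((d : ℝ) - 1) * b ^ 2 ≤ 4 * ((d : ℝ) - 1) * t :=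
            mul_le_mul_of_nonneg_left hsq (by linarith)
        _ ≤ 4 * (d : ℝ) * t := by nlinarith
    have hdd : (d : ℝ) * t ≤ (d : ℝ) ^ 2 * t := by
      apply mul_le_mul_of_nonneg_right _ ht0; nlinarith
    linarith
  · -- hhalf: `≤ H·t ≤ 1/2`
    have hH := halfSum_le_of_small hd hb hbt hct ht1
    linarith
  · -- h512: `≤ 512(d+1)(d+4)L²·B·t ≤ 1`
    have hB := fillRadius_le_of_small hd L hb hbt hct ht1
    have hc512 : 0 ≤ 512 * ((d : ℝ) + 1) * ((d : ℝ) + 4) * (L : ℝ) ^ 2 := by positivity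
    calc _ ≤ 512 * ((d : ℝ) + 1) * ((d : ℝ) + 4) * (L : ℝ) ^ 2 * (B * t) := mul_le_mul_of_nonneg_left hB hc512
      _ = 512 * ((d : ℝ) + 1) * ((d : ℝ) + 4) * (L : ℝ) ^ 2 * B * t := by ring
      _ ≤ 1 := h512K

end

end Summit.QuantumFields.BalabanUV.T4Continuum.ApproxRefineRegime
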